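import Summits.BirchSwinnertonDyer.BirchSwinnertonDyer.Theorems.KolyvaginDepthDoorKolyvaginDepthSupplyRankTwo
import HarnessLib

/-!
# Route `KolyvaginDepthDoor`, crux `KolyvaginDepthSupply` (stmt-BirchSwinnertonDyer-21765) — the
# instrument's READING RULE: the depth of the first non-zero Kolyvagin class MEASURES
# `corank_{ℤ_p} Ш(E)[p^∞]` (it is `rank E(ℚ) − 1 + t_p`), modulo Kolyvagin 1991 Thm. 4 (+ BCGS 2026)

Helper file (`--supports stmt-BirchSwinnertonDyer-21765 --as helper`); it closes nothing and BSD is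
not proved by it. The companions give the DOOR (`…KolyvaginDepthSupplyDoor`: a non-zero class at depth
`≤ rank − 1` ⇒ `t_p = 0`) and the SUPPLY (`…KolyvaginDepthSupplyRankTwo`: `t_p = 0` ⇒ the minimal
non-zero class sits at depth exactly `rank − 1`), i.e. the depth table as a YES/NO certificate of
`t_p := corank_{ℤ_p} Ш(E/ℚ)[p^∞] = 0`. This file records the QUANTITATIVE reading, which is what makes
the table an instrument for the invisible quantity `t_p` itself (the divisible part of `Ш`, which no
descent sees — `Literature.Barriers.BirchSwinnertonDyer.SelmerRankBarrierNarrow`):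

* `minimalDepth_add_one_eq_max` — modulo Kolyvagin 1991 Thm. 4 (`hF`): at a non-zero class of MINIMAL
  depth `ν₀`, `ν₀ + 1 = max(c, c')` (`c = corank Sel_{p^∞}(E/ℚ)`, `c'` the same for `E^{(d_K)}`) —
  the dichotomy read as one equation.
* `minimalDepth_eq_rank_sub_one_add_shaCorank` — if moreover `c' + 1 ≤ rank E(ℚ)` (the regime of
  every admissible Heegner field the route uses: `ord L(E^{(d_K)}) ≤ 1`, so `c' = rank E^{(d_K)} ≤ 1`),
  then **`ν₀ = (rank E(ℚ) − 1) + t_p`**: the first non-zero depth, minus `rank − 1`, IS the corank of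
  `Ш(E)[p^∞]` (Kummer `c = rank + t_p`, proved in the tree). Door and supply are its cases `t_p = 0`.
* `minimalDepth_eq_one_add_shaCorank_of_rank_two` — the rank-2 row reading: with `c' ≤ 1`, the
  table's first non-zero depth is `1 + t_p`; in particular (`depth_two_le_iff_shaCorank_pos_of_rank_two`)
  ALL first derived classes `c_M(ℓ)` vanish (every Kolyvagin prime `ℓ`, every `M`) iff `t_p ≥ 1` —
  what a counterexample to X1 would look like in the table.
* `exists_minimal_kolyvaginClass_depth_eq_rank_sub_one_add_shaCorank` — with BCGS 2026 Thm. 1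
  (`hA`, the non-vanishing of the system) the minimal class EXISTS unconditionally in the crux's
  regime (`p ≥ 5` good ordinary, `ρ̄_{E,p}` onto, `d_K` odd, `p` split), so the reading is never
  vacuous: for rank `r ≥ 1` and `c' ≤ r − 1` there IS a non-zero class of minimal depth, and that
  depth equals `r − 1 + t_p`.

All statements are modulo the named facts `hF` (and `hA`); by
`kolyvagin1991_of_padicSurj` (`…DepthTableOddPrimeKit`) `hF` may be replaced by Kolyvagin's printed
`B(E)` form. Per-curve readings, not class theorems.

References: [Kolyvagin1991MathAnn] §2 Thm. 4 (= typescript Thm. 2.3); [WZhang2014] Thm. 11.2 (i);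
[BurungaleEtAl2026] Thm. 1; [GreenbergLNM1716] §1; [JetchevLauterStein2009] §3.6.
-/

-- D-0017: single-problem summit, `Summit.BirchSwinnertonDyer.BirchSwinnertonDyer.…` repeats a
-- namespace component by design.
set_option linter.dupNamespace false

noncomputable section

open scoped Classical

namespace Summit.BirchSwinnertonDyer.BirchSwinnertonDyer.Theorems.KolyvaginDepthDoor

open Literature.NumberTheory.EllipticCurves Literature.NumberTheory.EllipticCurves.ModularForms
  WeierstrassCurve

/-! ## The reading rule at the minimiser (binders = those of Kolyvagin's fact, plus minimality) -/

/-- **The dichotomy as one equation (modulo Kolyvagin 1991 Thm. 4).** In the setting of the fact, at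
a non-zero class `c_M(n) ≠ 0` of MINIMAL depth `ν₀ = ν(n)` among the non-zero classes of its system:
`ν₀ + 1 = max(corank Sel_{p^∞}(E/ℚ), corank Sel_{p^∞}(E^{(d_K)}/ℚ))` (one corank is `ν₀ + 1`, the
other is `≤ ν₀`). CONDITIONAL on `hF`. [cite: Kolyvagin1991MathAnn, §2 Thm. 4 (= typescript Thm. 2.3)]
[cite: WZhang2014, Thm. 11.2 (i) (p. 248)] -/
theorem minimalDepth_add_one_eq_max
    (hF : Kolyvagin1991_selmerCorank_of_kolyvaginClass_ne_zero)
    (W : WeierstrassCurve ℚ) [W.IsElliptic] [W.IsGloballyMinimal] (p : ℕ) [hp : Fact p.Prime]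
    (h5 : 5 ≤ p) (hsurj : W.HasSurjectiveModNGaloisRep p)
    (K : Type) [Field K] [NumberField K] (hK : IsImaginaryQuadratic K)
    (h3 : NumberField.discr K ≠ -3) (h4 : NumberField.discr K ≠ -4)
    (hpd : ¬ ((p : ℤ) ∣ NumberField.discr K)) (hpN : ¬ (p ∣ W.conductorNorm ℤ))
    [NeZero (W.conductorNorm ℤ)] (hH : SatisfiesHeegnerHypothesis (W.conductorNorm ℤ) K)
    (Dt : ModularParametrizationData W (W.conductorNorm ℤ)) (β : ℤ) (ι : K →+* ℂ) (n : ℕ)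
    (d : KolyvaginHeegnerData Dt β ι n) (M : ℕ)
    (hΛ : KolyvaginDescent.KolSupp (Zhang2014.IsKolyvaginPrime (W.conductorNorm ℤ) W K p) n)
    (hM : 1 ≤ M) (hMle : (M : ℕ∞) ≤ Zhang2014.levelIndex W p n)
    (hne : d.kolyvaginClass hp.out M ≠ 0)
    (hmin : ∀ (n' : ℕ) (d' : KolyvaginHeegnerData Dt β ι n') (M' : ℕ),
      KolyvaginDescent.KolSupp (Zhang2014.IsKolyvaginPrime (W.conductorNorm ℤ) W K p) n' →
      1 ≤ M' → (M' : ℕ∞) ≤ Zhang2014.levelIndex W p n' → d'.kolyvaginClass hp.out M' ≠ 0 →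
      n.primeFactors.card ≤ n'.primeFactors.card) :
    n.primeFactors.card + 1 =
      max (W.selmerCorank p) ((W.quadraticTwist (NumberField.discr K : ℚ)).selmerCorank p) := by
  have hstruct := hF W p h5 hsurj K hK h3 h4 hpd hpN hH Dt β ι n d M hΛ hM hMle hne hmin
  rcases hstruct with ⟨hc, hc', -⟩ | ⟨hc', hc, -⟩
  · rw [max_eq_left (by omega)]; omega
  · rw [max_eq_right (by omega)]; omega

/-- **The reading rule: the first non-zero depth is `(rank E(ℚ) − 1) + corank_{ℤ_p} Ш(E)[p^∞]`
(modulo Kolyvagin 1991 Thm. 4).** Same setting, at a non-zero class of minimal depth `ν₀`; if the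
twist's Selmer corank satisfies `c' + 1 ≤ rank E(ℚ)` (e.g. `c' ≤ 1 ≤ rank − 1`, the route's Heegner
fields), then `ν₀ = rank E(ℚ) − 1 + t_p` with `t_p = corank_{ℤ_p} Ш(E/ℚ)[p^∞]`: by Kummer
(`selmerCorank_eq_mordellWeilRank_add_holds`) `c = rank + t_p ≥ rank > c'`, so the dichotomy is
`c = ν₀ + 1`. The door (`ν₀ ≤ rank − 1 ⇒ t_p = 0`) and the supply (`t_p = 0 ⇒ ν₀ = rank − 1`) are its
two readings; in general the depth table MEASURES `t_p`. CONDITIONAL on `hF`; per-curve; BSD is not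
proved by it. [cite: Kolyvagin1991MathAnn, §2 Thm. 4 (= typescript Thm. 2.3)]
[cite: GreenbergLNM1716, §1 pp. 54–57] -/
theorem minimalDepth_eq_rank_sub_one_add_shaCorank
    (hF : Kolyvagin1991_selmerCorank_of_kolyvaginClass_ne_zero)
    (W : WeierstrassCurve ℚ) [W.IsElliptic] [W.IsGloballyMinimal] (p : ℕ) [hp : Fact p.Prime]
    (h5 : 5 ≤ p) (hsurj : W.HasSurjectiveModNGaloisRep p)
    (K : Type) [Field K] [NumberField K] (hK : IsImaginaryQuadratic K)
    (h3 : NumberField.discr K ≠ -3) (h4 : NumberField.discr K ≠ -4)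
    (hpd : ¬ ((p : ℤ) ∣ NumberField.discr K)) (hpN : ¬ (p ∣ W.conductorNorm ℤ))
    [NeZero (W.conductorNorm ℤ)] (hH : SatisfiesHeegnerHypothesis (W.conductorNorm ℤ) K)
    (Dt : ModularParametrizationData W (W.conductorNorm ℤ)) (β : ℤ) (ι : K →+* ℂ) (n : ℕ)
    (d : KolyvaginHeegnerData Dt β ι n) (M : ℕ)
    (hΛ : KolyvaginDescent.KolSupp (Zhang2014.IsKolyvaginPrime (W.conductorNorm ℤ) W K p) n)
    (hM : 1 ≤ M) (hMle : (M : ℕ∞) ≤ Zhang2014.levelIndex W p n)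
    (hne : d.kolyvaginClass hp.out M ≠ 0)
    (hmin : ∀ (n' : ℕ) (d' : KolyvaginHeegnerData Dt β ι n') (M' : ℕ),
      KolyvaginDescent.KolSupp (Zhang2014.IsKolyvaginPrime (W.conductorNorm ℤ) W K p) n' →
      1 ≤ M' → (M' : ℕ∞) ≤ Zhang2014.levelIndex W p n' → d'.kolyvaginClass hp.out M' ≠ 0 →
      n.primeFactors.card ≤ n'.primeFactors.card)
    (hc' : (W.quadraticTwist (NumberField.discr K : ℚ)).selmerCorank p + 1 ≤ W.mordellWeilRank) :
    n.primeFactors.card = W.mordellWeilRank - 1 + W.shaCorank p := by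
  have hmax := minimalDepth_add_one_eq_max hF W p h5 hsurj K hK h3 h4 hpd hpN hH Dt β ι n d M hΛ hM
    hMle hne hmin
  have hid : W.selmerCorank p = W.mordellWeilRank + W.shaCorank p :=
    W.selmerCorank_eq_mordellWeilRank_add_holds p
  rw [max_eq_left (by omega)] at hmax
  omega

/-- **Rank-2 reading: the first non-zero depth is `1 + t_p`** (modulo Kolyvagin 1991 Thm. 4). For a
globally minimal `E/ℚ` of rank `2` and an admissible `(p, K)` with `corank Sel_{p^∞}(E^{(d_K)}/ℚ) ≤ 1`,
a non-zero class of minimal depth `ν₀` has `ν₀ = 1 + corank_{ℤ_p} Ш(E/ℚ)[p^∞]`. So a depth table whose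
FIRST derived classes `c_M(ℓ)` all vanish but which has a non-zero class at depth `2` exhibits
`t_p = 1` — the shape of a counterexample to X1 at `(E, p)`. CONDITIONAL on `hF`; per-curve.
[cite: Kolyvagin1991MathAnn, §2 Thm. 4 (= typescript Thm. 2.3)] [cite: JetchevLauterStein2009, §3.6 (arXiv:0707.0032)] -/
theorem minimalDepth_eq_one_add_shaCorank_of_rank_two
    (hF : Kolyvagin1991_selmerCorank_of_kolyvaginClass_ne_zero)
    (W : WeierstrassCurve ℚ) [W.IsElliptic] [W.IsGloballyMinimal] (p : ℕ) [hp : Fact p.Prime]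
    (h5 : 5 ≤ p) (hsurj : W.HasSurjectiveModNGaloisRep p)
    (K : Type) [Field K] [NumberField K] (hK : IsImaginaryQuadratic K)
    (h3 : NumberField.discr K ≠ -3) (h4 : NumberField.discr K ≠ -4)
    (hpd : ¬ ((p : ℤ) ∣ NumberField.discr K)) (hpN : ¬ (p ∣ W.conductorNorm ℤ))
    [NeZero (W.conductorNorm ℤ)] (hH : SatisfiesHeegnerHypothesis (W.conductorNorm ℤ) K)
    (Dt : ModularParametrizationData W (W.conductorNorm ℤ)) (β : ℤ) (ι : K →+* ℂ) (n : ℕ)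
    (d : KolyvaginHeegnerData Dt β ι n) (M : ℕ)
    (hΛ : KolyvaginDescent.KolSupp (Zhang2014.IsKolyvaginPrime (W.conductorNorm ℤ) W K p) n)
    (hM : 1 ≤ M) (hMle : (M : ℕ∞) ≤ Zhang2014.levelIndex W p n)
    (hne : d.kolyvaginClass hp.out M ≠ 0)
    (hmin : ∀ (n' : ℕ) (d' : KolyvaginHeegnerData Dt β ι n') (M' : ℕ),
      KolyvaginDescent.KolSupp (Zhang2014.IsKolyvaginPrime (W.conductorNorm ℤ) W K p) n' →
      1 ≤ M' → (M' : ℕ∞) ≤ Zhang2014.levelIndex W p n' → d'.kolyvaginClass hp.out M' ≠ 0 →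
      n.primeFactors.card ≤ n'.primeFactors.card)
    (hr : W.mordellWeilRank = 2)
    (hc' : (W.quadraticTwist (NumberField.discr K : ℚ)).selmerCorank p ≤ 1) :
    n.primeFactors.card = 1 + W.shaCorank p := by
  have h := minimalDepth_eq_rank_sub_one_add_shaCorank hF W p h5 hsurj K hK h3 h4 hpd hpN hH Dt β ι n
    d M hΛ hM hMle hne hmin (by omega)
  omega

/-- **Rank 2: "every first derived class vanishes" ⟺ `t_p ≥ 1`, read at the minimiser** (modulo
Kolyvagin 1991 Thm. 4): with `rank E(ℚ) = 2`, `c' ≤ 1` and a non-zero class of minimal depth `ν₀`,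
`2 ≤ ν₀ ↔ 0 < corank_{ℤ_p} Ш(E/ℚ)[p^∞]`. CONDITIONAL on `hF`; per-curve.
[cite: Kolyvagin1991MathAnn, §2 Thm. 4 (= typescript Thm. 2.3)] -/
theorem depth_two_le_iff_shaCorank_pos_of_rank_two
    (hF : Kolyvagin1991_selmerCorank_of_kolyvaginClass_ne_zero)
    (W : WeierstrassCurve ℚ) [W.IsElliptic] [W.IsGloballyMinimal] (p : ℕ) [hp : Fact p.Prime]
    (h5 : 5 ≤ p) (hsurj : W.HasSurjectiveModNGaloisRep p)
    (K : Type) [Field K] [NumberField K] (hK : IsImaginaryQuadratic K)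
    (h3 : NumberField.discr K ≠ -3) (h4 : NumberField.discr K ≠ -4)
    (hpd : ¬ ((p : ℤ) ∣ NumberField.discr K)) (hpN : ¬ (p ∣ W.conductorNorm ℤ))
    [NeZero (W.conductorNorm ℤ)] (hH : SatisfiesHeegnerHypothesis (W.conductorNorm ℤ) K)
    (Dt : ModularParametrizationData W (W.conductorNorm ℤ)) (β : ℤ) (ι : K →+* ℂ) (n : ℕ)
    (d : KolyvaginHeegnerData Dt β ι n) (M : ℕ)
    (hΛ : KolyvaginDescent.KolSupp (Zhang2014.IsKolyvaginPrime (W.conductorNorm ℤ) W K p) n)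
    (hM : 1 ≤ M) (hMle : (M : ℕ∞) ≤ Zhang2014.levelIndex W p n)
    (hne : d.kolyvaginClass hp.out M ≠ 0)
    (hmin : ∀ (n' : ℕ) (d' : KolyvaginHeegnerData Dt β ι n') (M' : ℕ),
      KolyvaginDescent.KolSupp (Zhang2014.IsKolyvaginPrime (W.conductorNorm ℤ) W K p) n' →
      1 ≤ M' → (M' : ℕ∞) ≤ Zhang2014.levelIndex W p n' → d'.kolyvaginClass hp.out M' ≠ 0 →
      n.primeFactors.card ≤ n'.primeFactors.card)
    (hr : W.mordellWeilRank = 2)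
    (hc' : (W.quadraticTwist (NumberField.discr K : ℚ)).selmerCorank p ≤ 1) :
    2 ≤ n.primeFactors.card ↔ 0 < W.shaCorank p := by
  have h := minimalDepth_eq_one_add_shaCorank_of_rank_two hF W p h5 hsurj K hK h3 h4 hpd hpN hH Dt β
    ι n d M hΛ hM hMle hne hmin hr hc'
  omega

/-- **The reading is never vacuous in the crux's regime (modulo BCGS 2026 Thm. 1 + Kolyvagin 1991
Thm. 4).** `E/ℚ` globally minimal of rank `r`; `p ≥ 5` good ordinary with `ρ̄_{E,p}` onto; `K`
imaginary quadratic with the Heegner hypothesis for `N_E`, `d_K` odd, `∉ {−3, −4}`, `p ∤ d_K`, `p`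
split; `corank Sel_{p^∞}(E^{(d_K)}/ℚ) + 1 ≤ r`. Then the Kolyvagin–Heegner system attached to some
`(Dt, β, ι)` has a non-zero class (BCGS), hence a non-zero class of MINIMAL depth, and that depth is
EXACTLY `r − 1 + corank_{ℤ_p} Ш(E/ℚ)[p^∞]`. (The companion
`exists_kolyvaginClass_ne_zero_depth_eq_rank_sub_one` is the case `t_p = 0` read backwards.)
CONDITIONAL on `hA`, `hF`; per-curve; BSD is not proved by it.
[cite: BurungaleEtAl2026, Thm. 1 (arXiv:2312.09301 §0.1)] [cite: Kolyvagin1991MathAnn, §2 Thm. 4 (= typescript Thm. 2.3)]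
[cite: GreenbergLNM1716, §1 pp. 54–57] -/
theorem exists_minimal_kolyvaginClass_depth_eq_rank_sub_one_add_shaCorank
    (hA : BurungaleEtAl2026_exists_kolyvaginClass_ne_zero)
    (hF : Kolyvagin1991_selmerCorank_of_kolyvaginClass_ne_zero)
    (W : WeierstrassCurve ℚ) [W.IsElliptic] [W.IsGloballyMinimal]
    (p : ℕ) [hp : Fact p.Prime] (h5 : 5 ≤ p) (hgood : W.HasGoodReductionAtPrime p)
    (hord : ¬ (p : ℤ) ∣ W.frobeniusTrace p) (hsurj : W.HasSurjectiveModNGaloisRep p)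
    (K : Type) [Field K] [NumberField K] (hK : IsImaginaryQuadratic K)
    (h3 : NumberField.discr K ≠ -3) (h4 : NumberField.discr K ≠ -4)
    (hpd : ¬ ((p : ℤ) ∣ NumberField.discr K)) [NeZero (W.conductorNorm ℤ)]
    (hH : SatisfiesHeegnerHypothesis (W.conductorNorm ℤ) K) (hodd : Odd (NumberField.discr K))
    (hps : SatisfiesHeegnerHypothesis p K)
    (hc' : (W.quadraticTwist (NumberField.discr K : ℚ)).selmerCorank p + 1 ≤ W.mordellWeilRank) :
    ∃ (Dt : ModularParametrizationData W (W.conductorNorm ℤ)) (β : ℤ) (ι : K →+* ℂ) (n : ℕ)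
      (d : KolyvaginHeegnerData Dt β ι n) (M : ℕ),
      KolyvaginDescent.KolSupp (Zhang2014.IsKolyvaginPrime (W.conductorNorm ℤ) W K p) n ∧
      1 ≤ M ∧ (M : ℕ∞) ≤ Zhang2014.levelIndex W p n ∧ d.kolyvaginClass hp.out M ≠ 0 ∧
      (∀ (n' : ℕ) (d' : KolyvaginHeegnerData Dt β ι n') (M' : ℕ),
        KolyvaginDescent.KolSupp (Zhang2014.IsKolyvaginPrime (W.conductorNorm ℤ) W K p) n' →
        1 ≤ M' → (M' : ℕ∞) ≤ Zhang2014.levelIndex W p n' → d'.kolyvaginClass hp.out M' ≠ 0 →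
        n.primeFactors.card ≤ n'.primeFactors.card) ∧
      n.primeFactors.card = W.mordellWeilRank - 1 + W.shaCorank p := by
  have hpP : p.Prime := hp.out
  -- (irr), (tor) from surjectivity; `p ∤ N_E` from good reduction
  have hirr : W.HasIrreducibleModPGaloisRep p :=
    hasIrreducibleModPGaloisRep_of_hasSurjectiveModNGaloisRep W p hsurj
  have htor : AddSubgroup.torsionBy (W.baseChange K).toAffine.Point (p : ℤ) = ⊥ :=
    torsionBy_eq_bot_of_isImaginaryQuadratic W K hK hpP (by omega) hsurj
  have hpN : ¬ (p ∣ W.conductorNorm ℤ) := fun h ↦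
    (W.dvd_conductorNorm_iff_not_hasGoodReductionAtPrime p).mp h hgood
  -- BCGS Thm. 1: some class of the system attached to `(Dt, β, ι)` is non-zero
  obtain ⟨Dt, β, ι, n₁, d₁, M₁, hΛ₁, hM₁, hM₁le, hne₁⟩ :=
    hA W p (by omega) hgood hord hirr K hK hH hodd h3 htor hps
  -- the minimiser
  obtain ⟨n₀, d₀, M₀, hΛ₀, hM₀, hM₀le, hne₀, -, hmin, -⟩ :=
    exists_minimal_kolyvaginClass_ne_zero hF W p h5 hsurj K hK h3 h4 hpd hpN hH Dt β ι n₁ d₁ M₁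
      hΛ₁ hM₁ hM₁le hne₁
  exact ⟨Dt, β, ι, n₀, d₀, M₀, hΛ₀, hM₀, hM₀le, hne₀, hmin,
    minimalDepth_eq_rank_sub_one_add_shaCorank hF W p h5 hsurj K hK h3 h4 hpd hpN hH Dt β ι n₀ d₀ M₀
      hΛ₀ hM₀ hM₀le hne₀ hmin hc'⟩

end Summit.BirchSwinnertonDyer.BirchSwinnertonDyer.Theorems.KolyvaginDepthDoor

end
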